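import Summits.ResolutionOfSingularities.ResolutionOfSingularities.Theorems.FrobeniusLadderFInjectiveMacaulayficationFiLocusOpenOfAffine
import Literature.AlgebraicGeometry.Resolution.FInjectiveLocusOpen
import Literature.RingTheory.IntegralClosure.KrullIntersection
import Mathlib.AlgebraicGeometry.Morphisms.QuasiCompact
import Mathlib.AlgebraicGeometry.Properties
import HarnessLib.Audit
import HarnessLib

/-!
# FC′ surface rung r2, file F2: the clause predicates, `CMLocusOpen`, `NonFullLocusClosed`, and two of the four inputs of the
# dim ≤ 2 rung discharged (crux `FInjectiveMacaulayfication` stmt-ResolutionOfSingularities-15315, chain w45a, hole #3γ;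
# res-L1-w45a-plan-1 R13.25 (2) / R13.26 (1) / R13.31 (2); seat res-L1-w45a-stub-3)

[candidate statements + kernel, OURS · L1 W4.5a · res-L1-w45a-stub-3 filing res-L1-w45a-strat-1's `FCRungsSig.lean` v2.4 §B/§B7
VERBATIM (cell copy `L/res-L1-w45a-strat-1/FCRungsSig-v24-6f0b099b68c12d90.lean`, FILE SPLIT 13:58:18Z of record, tri-2 junk pass
PRE-PASSED R13.32 (4))]. NOT a statement of any manuscript; AI-written (AI review is weaker than expert review). Support file
(`--supports stmt-ResolutionOfSingularities-15315 --as helper`); second of the five files F1–F5 of the FC′ SURFACE RUNG (plan-1 R13.26).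

* `Clause p R` / `CMClause R` / `FIClause p R`, `clause_iff` — the crux's inline per-stalk clause («every system of parameters is weakly
  regular and generates a Frobenius-closed ideal»), its Cohen–Macaulay half and its Frobenius-closure half, as named predicates
  definitionally equal to the verbatim text of `GenericFibreReduction.FCForallExists`;
* `CMLocusOpen` (INPUT S-CMo, `@[conjecture]` until the Literature fact is typed) — the Cohen–Macaulay locus of a scheme locally of finite
  type over a field is open (EGA IV₂ 6.11.2 (ii) / 7.8.3 (iv); restriction to finite type over a field is load-bearing — Hochster 1973);
* `NonFullLocusClosed` (S-DM) — the non-FULL locus of an integral `k`-scheme of finite type is closed — and its discharge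
  `nonFullLocusClosed_of_named : DattaMurayama2024_fInjectiveLocusOpen → CMLocusOpen → NonFullLocusClosed` (the route's named fact #2
  BY NAME, L-USE, through `FiLocusOpenOfAffine.fiLocusOpen_of_ringLevel` on the open Cohen–Macaulay subscheme);
* `regularOfNormalDimLeOne` (S-N1, a THEOREM): an integrally closed Noetherian local domain of dimension `≤ 1` is regular — the tree's
  `Literature.RingTheory.IntegralClosure.isRegularLocalRing_of_isIntegrallyClosed_of_ringKrullDim_le_one`.

Consumers: F3 `…FCForallExistsDimLe2` (stub-2: kernel `fcForallExistsDimLe2_of_named (hDM) (hCMo) (hS2) (hV)`), F5 `…FCForallExistsRungs`.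
[cite: DattaMurayama2024, Thm. B; Matsumura1987, Thm. 11.2; EGAIV2, 6.11.2]
-/

-- single-problem summit: the doubled namespace component is forced
set_option linter.dupNamespace false

noncomputable section

open AlgebraicGeometry CategoryTheory Literature.AlgebraicGeometry.Resolution TopologicalSpace IsLocalRing

namespace Summit.ResolutionOfSingularities.ResolutionOfSingularities.Theorems.FInjectiveMacaulayfication.NonFullLocusClosed

open Summit.ResolutionOfSingularities.ResolutionOfSingularities.Theorems.FInjectiveMacaulayfication

/-! ## The clause predicates -/

/-- The crux's inline clause at a ring `R` — every system of parameters weakly regular with Frobenius-closed ideal — WITHOUT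
the domain conjunct; an abbreviation definitionally equal to the verbatim text of `FCForallExists`. [OURS] -/
def Clause (p : ℕ) (R : Type) [CommRing R] : Prop :=
  ∀ d : ℕ, ringKrullDim R = d → ∀ s : Fin d → R, (Ideal.span (Set.range s)).radical.IsMaximal →
    RingTheory.Sequence.IsWeaklyRegular R (List.ofFn s) ∧
    ∀ t : R, (∃ e : ℕ, t ^ p ^ e ∈ Ideal.span ((fun z : R => z ^ p ^ e) '' (Ideal.span (Set.range s) : Set R))) →
      t ∈ Ideal.span (Set.range s)

/-- The Cohen–Macaulay clause at a ring `R` (every system of parameters weakly regular), verbatim as in the crux. [OURS] -/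
def CMClause (R : Type) [CommRing R] : Prop :=
  ∀ d : ℕ, ringKrullDim R = d → ∀ s : Fin d → R, (Ideal.span (Set.range s)).radical.IsMaximal →
    RingTheory.Sequence.IsWeaklyRegular R (List.ofFn s)

/-- The Frobenius-closure clause at a ring `R` (every parameter ideal Frobenius closed, inline form), verbatim as in the crux. [OURS] -/
def FIClause (p : ℕ) (R : Type) [CommRing R] : Prop :=
  ∀ d : ℕ, ringKrullDim R = d → ∀ s : Fin d → R, (Ideal.span (Set.range s)).radical.IsMaximal →
    ∀ t : R, (∃ e : ℕ, t ^ p ^ e ∈ Ideal.span ((fun z : R => z ^ p ^ e) '' (Ideal.span (Set.range s) : Set R))) →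
      t ∈ Ideal.span (Set.range s)

/-- `Clause = CMClause ∧ FIClause`. [folklore] -/
theorem clause_iff (p : ℕ) (R : Type) [CommRing R] : Clause p R ↔ CMClause R ∧ FIClause p R := by
  constructor
  · intro h
    exact ⟨fun d hd s hs => (h d hd s hs).1, fun d hd s hs => (h d hd s hs).2⟩
  · rintro ⟨h1, h2⟩ d hd s hs
    exact ⟨h1 d hd s hs, h2 d hd s hs⟩

/-! ## The inputs S-CMo and S-DM of the dim ≤ 2 rung, and S-N1 -/

/-- §B1′ INPUT S-CMo [EGA] **the Cohen–Macaulay locus of a scheme locally of finite type over a field is open**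
(EGA IV₂ 6.11.2 (ii) / 7.8.3 (iv): excellent schemes). Not yet typed in the tree as a Literature fact; to be replaced BY NAME by
that fact when typed (plan-1 ask (c)). The restriction «locally of finite type over a field» is load-bearing: for general
Noetherian schemes the Cohen–Macaulay locus need not be open (Hochster 1973). Why it might fail: only by a typing slip.
[candidate statement, OURS; cite: EGAIV2, 6.11.2 and 7.8.3] -/
@[conjecture] def CMLocusOpen : Prop :=
  ∀ (k : Type) [Field k] (X : Scheme.{0}) (f : X ⟶ Spec (.of k)), LocallyOfFiniteType f →
    IsOpen {x : X | CMClause (X.presheaf.stalk x)}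

/-- §B1 INPUT S-DM [candidate statement, OURS] **the non-FULL locus of an integral `k`-scheme of finite type is closed**
(`k` any field of characteristic `p`; FULL = Cohen–Macaulay with Frobenius-closed parameter ideals = Cohen–Macaulay and
F-injective, Quy–Shimomoto 2017 Cor. 3.9). ⇐ `DattaMurayama2024_fInjectiveLocusOpen` on the open Cohen–Macaulay locus +
[EGA IV_2 6.11.2 / 7.8.3 (iv)] (openness of the Cohen–Macaulay locus of an excellent scheme; `CMLocusOpen`) —
`nonFullLocusClosed_of_named`. Why it might fail: only by a typing slip (the printed theorems cover it).
[candidate statement, OURS; cite: DattaMurayama2024, Thm. B; EGAIV2, 7.8.3 (iv)] -/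
@[conjecture] def NonFullLocusClosed : Prop :=
  ∀ (p : ℕ), p.Prime → ∀ (k : Type) [Field k] [CharP k p] (X : Scheme.{0}) (f : X ⟶ Spec (.of k)),
    LocallyOfFiniteType f → QuasiCompact f → IsIntegral X →
    IsClosed {x : X | ¬ Clause p (X.presheaf.stalk x)}

set_option linter.overlappingInstances false in
-- a local domain: the two instance binders overlap in `Nontrivial`, exactly as in the tree theorem being restated
/-- §B3 S-N1 [folklore] **an integrally closed Noetherian local domain of dimension `≤ 1` is regular** (a field or a DVR;
Matsumura Thm. 11.2) — the tree's `Literature.RingTheory.IntegralClosure.isRegularLocalRing_of_isIntegrallyClosed_of_ringKrullDim_le_one`,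
restated in the binder shape the dim ≤ 2 kernel consumes. [cite: Matsumura1987, Thm. 11.2] -/
theorem regularOfNormalDimLeOne : ∀ (R : Type) [CommRing R] [IsDomain R] [IsNoetherianRing R] [IsLocalRing R],
    IsIntegrallyClosed R → ringKrullDim R ≤ 1 → IsRegularLocalRing R := by
  intro R _ _ _ _ hic hd
  haveI := hic
  exact Literature.RingTheory.IntegralClosure.isRegularLocalRing_of_isIntegrallyClosed_of_ringKrullDim_le_one R hd

/-- §B1 ⇐ named fact + S-CMo: **the non-FULL locus is closed**, from Datta–Murayama 2024 Thm. B (the route's named fact #2, used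
BY NAME through `FiLocusOpenOfAffine.fiLocusOpen_of_ringLevel` on the open Cohen–Macaulay subscheme) and openness of the
Cohen–Macaulay locus: the FULL locus is the image of the F-injective locus of the open Cohen–Macaulay subscheme `U`, open in `U`
by the named fact, hence open in `X`. [folklore assembly; cite: DattaMurayama2024, Thm. B] -/
theorem nonFullLocusClosed_of_named
    (hDM : Literature.AlgebraicGeometry.Resolution.DattaMurayama2024_fInjectiveLocusOpen.{0})
    (hCMo : CMLocusOpen) : NonFullLocusClosed := by
  intro p hp k _ _ X f hft _hqc _hint
  haveI := hft
  -- the open Cohen–Macaulay locus as an open subscheme `U`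
  let U : X.Opens := ⟨{x : X | CMClause (X.presheaf.stalk x)}, hCMo k X f hft⟩
  have e : ∀ u : U, X.presheaf.stalk (U.ι.base u) ≃+* (U : Scheme.{0}).presheaf.stalk u :=
    fun u => (asIso (U.ι.stalkMap u)).commRingCatIsoToRingEquiv
  have hCMU : ∀ u : U, CMClause ((U : Scheme.{0}).presheaf.stalk u) :=
    fun u => FiLocusOpenOfAffine.cmClause_of_ringEquiv (e u) u.2
  -- Datta–Murayama on `U` (all stalks Cohen–Macaulay)
  have hV₀ : IsOpen {u : U | FIClause p ((U : Scheme.{0}).presheaf.stalk u)} :=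
    FiLocusOpenOfAffine.fiLocusOpen_of_ringLevel p k (hDM p hp k) (U : Scheme.{0}) (U.ι ≫ f) inferInstance hCMU
  have hV : IsOpen (U.ι.base '' {u : U | FIClause p ((U : Scheme.{0}).presheaf.stalk u)}) :=
    U.ι.isOpenEmbedding.isOpenMap _ hV₀
  have hset : {x : X | ¬ Clause p (X.presheaf.stalk x)} =
      (U.ι.base '' {u : U | FIClause p ((U : Scheme.{0}).presheaf.stalk u)})ᶜ := by
    ext x
    simp only [Set.mem_setOf_eq, Set.mem_compl_iff, Set.mem_image, not_exists, not_and]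
    constructor
    · intro hx u hu hux
      subst hux
      exact hx ((clause_iff p _).mpr ⟨u.2, FiLocusOpenOfAffine.fClause_of_ringEquiv p (e u).symm hu⟩)
    · intro hx hcl
      have hcm : CMClause (X.presheaf.stalk x) := ((clause_iff p _).mp hcl).1
      exact hx ⟨x, hcm⟩ (FiLocusOpenOfAffine.fClause_of_ringEquiv p (e ⟨x, hcm⟩) ((clause_iff p _).mp hcl).2) rfl
  rw [hset]
  exact hV.isClosed_compl

end Summit.ResolutionOfSingularities.ResolutionOfSingularities.Theorems.FInjectiveMacaulayfication.NonFullLocusClosed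

end
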